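import Mathlib

/-!
# Twisted purity forces an arity selection rule

An elementary bookkeeping lemma behind the «character wrap» of higher products on a
CM elliptic curve (and behind slot-wise character screens for words in such products):
suppose a finite group acts on a graded linear category and every morphism `f : X → Y`
of degree `d` that occurs carries a character of the form `κ·d + φ(Y) − φ(X)` in `ZMod m`
(«twisted purity» with potential `φ`).  If an `n`-ary operation of degree `2 − n`
(an `A∞`-product `mₙ`) is equivariant — the character of the output equals the sum of the
characters of the inputs — then either it vanishes or `κ·(n − 2) = 0` in `ZMod m`.
For the pair `{𝒪, 𝒪(o)}` on the equianharmonic curve (`m = 6`, `κ = 1`) this is the rule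
«`mₙ = 0` unless `n ≡ 2 (mod 6)`».

Only the arithmetic core is formalised: characters, degrees and the potential are abstract
functions on a chain of `n` composable morphisms; the conclusion is the congruence.
Nothing in this file is specific to any geometric situation and nothing here claims any case
of the Hodge conjecture.
-/

namespace Summit.Ventures.HSemireg.TwistedPurity

open Finset

/-- Telescoping over a chain: the potential differences along `n` composable morphisms
`X₀ → X₁ → ⋯ → Xₙ` sum to `φ(Xₙ) − φ(X₀)`. -/
theorem sum_potential_telescope {M : Type*} [AddCommGroup M] (n : ℕ)
    (φ : Fin (n + 1) → M) :
    (∑ i : Fin n, (φ i.succ - φ i.castSucc)) = φ (Fin.last n) - φ 0 := by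
  have h1 : (∑ j : Fin (n + 1), φ j) = φ 0 + ∑ i : Fin n, φ i.succ := Fin.sum_univ_succ φ
  have h2 : (∑ j : Fin (n + 1), φ j) = (∑ i : Fin n, φ i.castSucc) + φ (Fin.last n) :=
    Fin.sum_univ_castSucc φ
  have e1 : (∑ i : Fin n, φ i.succ) = (∑ j : Fin (n + 1), φ j) - φ 0 := by
    rw [h1]; abel
  have e2 : (∑ i : Fin n, φ i.castSucc) = (∑ j : Fin (n + 1), φ j) - φ (Fin.last n) := by
    rw [h2]; abel
  rw [Finset.sum_sub_distrib, e1, e2]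
  abel

/-- **Twisted purity ⇒ arity selection.**  Along a chain of `n` composable morphisms with
degrees `d i` and characters `χ i = κ·(d i) + φ(target) − φ(source)` (twisted purity with
potential `φ : Fin (n+1) → ZMod m`), let an `n`-ary operation produce a morphism from the
first to the last object of degree `dg = (∑ d i) + 2 − n` whose character `χg` obeys the same
purity rule.  If the operation is equivariant (`χg = ∑ χ i`), then `κ·(n − 2) = 0` in `ZMod m`.
Contrapositive: for `κ = 1`, every equivariant `mₙ` with `n ≢ 2 (mod m)` vanishes. -/
theorem arity_selection {m : ℕ} (κ : ZMod m) (n : ℕ) (d : Fin n → ℤ)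
    (φ : Fin (n + 1) → ZMod m) (χ : Fin n → ZMod m)
    (hχ : ∀ i, χ i = κ * ((d i : ℤ) : ZMod m) + (φ i.succ - φ i.castSucc))
    (dg : ℤ) (χg : ZMod m)
    (hdg : dg = (∑ i, d i) + 2 - n)
    (hχg : χg = κ * ((dg : ℤ) : ZMod m) + (φ (Fin.last n) - φ 0))
    (heq : χg = ∑ i, χ i) :
    κ * ((n : ZMod m) - 2) = 0 := by
  have hsum : (∑ i, χ i) = κ * (((∑ i, d i : ℤ)) : ZMod m) + (φ (Fin.last n) - φ 0) := by
    simp_rw [hχ]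
    rw [Finset.sum_add_distrib, sum_potential_telescope, ← Finset.mul_sum, Int.cast_sum]
  have hS : ((dg : ℤ) : ZMod m) = (((∑ i, d i : ℤ)) : ZMod m) + 2 - (n : ZMod m) := by
    rw [hdg]; push_cast; ring
  have E : κ * ((((∑ i, d i : ℤ)) : ZMod m) + 2 - (n : ZMod m)) + (φ (Fin.last n) - φ 0)
      = κ * (((∑ i, d i : ℤ)) : ZMod m) + (φ (Fin.last n) - φ 0) := by
    rw [← hS, ← hχg, heq, hsum]
  linear_combination (-1 : ZMod m) * E

/-- The equianharmonic instance: with `m = 6` and `κ = 1`, an equivariant non-trivial `mₙ`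
forces `(n : ZMod 6) = 2`, i.e. `n ≡ 2 (mod 6)` — so `m₃ = ⋯ = m₇ = 0` and `m₈` is the first
higher product that may survive. -/
theorem arity_selection_mod6 (n : ℕ) (d : Fin n → ℤ)
    (φ : Fin (n + 1) → ZMod 6) (χ : Fin n → ZMod 6)
    (hχ : ∀ i, χ i = ((d i : ℤ) : ZMod 6) + (φ i.succ - φ i.castSucc))
    (dg : ℤ) (χg : ZMod 6)
    (hdg : dg = (∑ i, d i) + 2 - n)
    (hχg : χg = ((dg : ℤ) : ZMod 6) + (φ (Fin.last n) - φ 0))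
    (heq : χg = ∑ i, χ i) :
    (n : ZMod 6) = 2 := by
  have h := arity_selection (1 : ZMod 6) n d φ χ (fun i => by rw [hχ i, one_mul]) dg χg hdg
    (by rw [hχg, one_mul]) heq
  rw [one_mul] at h
  exact sub_eq_zero.mp h

end Summit.Ventures.HSemireg.TwistedPurity
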